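import Summits.Ventures.DiscreteObjects.Hadamard.Order167NormalizerElementaryAbelian668

/-!
# H(668): an element of order 167, a centralising involution and a fixed-point-free inverting coset ⇒ H is a `V₄`-twisted
# array of FOUR circulant blocks whose two inverting block-rows are TRANSPOSED — the Ito-type shape (kernel dictionary)

Framing: lottery ticket; floor = certified bounds/negative ranges.

Cell pub-namedobj (venture DiscreteObjects), target (H), hadamard gen 22 (HANDOFF-H-g22 item 2(b), first step — the analogue of
gen 21's `Order167WilliamsonType668` for the Ito line).  `σ = (π, κ, d, e)` a signed automorphism of pair order `167` of a
Hadamard matrix `H` of order `668`; `τ = (π₁, κ₁, d₁, e₁)` a CENTRALISING signed automorphism whose pair is a non-trivial involution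
(index `≥ 2`, the Ito line of gen 19/21); `ρ = (π₂, κ₂, d₂, e₂)` an INVERTING signed automorphism (`μ ≡ 166`) such that NEITHER
`ρ` NOR `ρτ` fixes a row.  By gen 22, `ρ` is a pair-involution commuting (pairs) with `τ`, so the labels `P_g = π₁^{g₁} π₂^{g₂}`
(`g ∈ V₄ = ℤ/2 × ℤ/2`) form a Klein four-group of pairs in which `P_g` normalises `σ` with multiplier `μ^{g₂}`
(`+1` on the `τ`-row, `−1` on the `ρ`-rows).
* **`ito_orbitMap_bijective`**: `(g, s) ↦ π^s P_g x₀` is a bijection `V₄ × ℤ/167 ≃ rows`: the pair group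
  `⟨σ⟩ ⋊ V₄` (dihedral-type, order `668`) acts REGULARLY on the rows [a coincidence puts `P_{g+h} x₀` into the orbit of `x₀`:
  for `τ` this contradicts the free action of `C(σ)`, for `ρ` and `ρτ` it would give `4` fixed rows
  (`inverting_blocks_of_mem_orbFin`)]; the same on columns.
* **`exists_itoTypeArray_of_inverting_fpf`**: in these coordinates (after re-signing so that `σ` is a permutation automorphism)
  `H ≅ [θ(g,h) · A_{g+h}(ε_g (t − s))]` with a `±1` table `θ : V₄ × V₄ → {±1}`, FOUR `±1` sequences `A_k : ℤ/167 → {±1}` and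
  `ε_g = +1` on the block-rows `g ∈ {0, τ}`, `ε_g = −1` on the block-rows `g ∈ {ρ, ρτ}`: **a `V₄`-twisted `4 × 4` array of four
  circulant blocks of order `167` in which the two inverting block-rows carry the TRANSPOSED circulants — the shape of Ito's
  type-Q array `(A B C D / B −A D −C / Cᵀ −Dᵀ −Aᵀ Bᵀ / Dᵀ Cᵀ −Bᵀ −Aᵀ)` up to the sign table** (whose identification with the
  dicyclic cocycle is left to a successor, as gen 21 did for the Williamson table in `Order167QuaternionCocycle668`).
DICTIONARY / STRUCTURE of a hypothetical object (the regular action is the `D_{4w}`-cocyclic situation of Ito / Flannery 1997 /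
Horadam 2007 Thm 6.18 — replication-adjacent in conclusion, ours in hypothesis and proof); no existence claim; H(668) untouched;
HITS 0/4.  No `sorry`, no definitions (the array is a `Matrix.of` term), default heartbeats.
-/

namespace Summit.Ventures.DiscreteObjects.Hadamard

open Finset BigOperators Matrix

open Literature.Combinatorics.Designs.GoethalsSeidel (IsHadamardMatrix)

variable {ι : Type*} [Fintype ι] [DecidableEq ι]

/-- the non-zero element of `ZMod 2` -/
lemma zmod2_eq_one_of_ne_zero : ∀ z : ZMod 2, z ≠ 0 → z = 1 := by decide

section main
variable {H : Matrix ι ι ℤ} (hH : IsHadamardMatrix H) (hι : Fintype.card ι = 668)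
  {π κ : Equiv.Perm ι} {d e : ι → ℤ} (haut : IsSignedAut H π κ d e)
  (hπ : π ^ 167 = 1) (hκ : κ ^ 167 = 1) (hne : π ≠ 1 ∨ κ ≠ 1)
  {π₁ κ₁ π₂ κ₂ : Equiv.Perm ι} {d₁ e₁ d₂ e₂ : ι → ℤ}
  (h₁ : IsSignedAut H π₁ κ₁ d₁ e₁) (hc₁ : Commute π₁ π) (hc₁' : Commute κ₁ κ) (hi₁ : π₁ ^ 2 = 1) (hi₁' : κ₁ ^ 2 = 1)
  (hne₁ : π₁ ≠ 1 ∨ κ₁ ≠ 1)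
  (h₂ : IsSignedAut H π₂ κ₂ d₂ e₂) {μ : ℕ} (hn₂ : π₂ * π = π ^ μ * π₂) (hn₂' : κ₂ * κ = κ ^ μ * κ₂) (hμ : μ % 167 = 166)
  (hfp : ∀ x, π₂ x ≠ x) (hfp' : ∀ x, (π₂ * π₁) x ≠ x)
include hH hι haut hπ hκ hne h₁ hc₁ hc₁' hi₁ hi₁' hne₁ h₂ hn₂ hn₂' hμ hfp hfp'

/-- **the orbit labelling** `(g, s) ↦ π^s (P_g x₀)`, `P_g = π₁^{g₁} π₂^{g₂}`, **is a bijection** `V₄ × ℤ/167 ≃ rows`: the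
pair group `⟨σ⟩ ⋊ V₄` acts regularly (row side). -/
lemma ito_orbitMap_bijective (x₀ : ι) :
    Function.Bijective (fun a : (ZMod 2 × ZMod 2) × ZMod 167 =>
      (π ^ a.2.val) ((π₁ ^ a.1.1.val * π₂ ^ a.1.2.val) x₀)) := by
  rw [Fintype.bijective_iff_injective_and_card]
  refine ⟨?_, by simp [ZMod.card, hι]⟩
  have p167 : Nat.Prime 167 := by norm_num
  have h167 := hadamard668_fixedRows_167 hH hι π κ d e haut hπ hκ hne
  have hπfix : ∀ x, π x ≠ x := moved_of_card_fixed_eq_zero π h167.1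
  obtain ⟨hi₂, hi₂'⟩ := hadamard668_order167_inverting_sq_eq_one hH hι haut hπ hκ hne h₂ hn₂ hn₂' hμ
  obtain ⟨hcm, -⟩ := hadamard668_order167_inverting_commute_involution hH hι haut hπ hκ hne h₂ hn₂ hn₂' hμ h₁ hc₁ hc₁' hi₁ hi₁'
  -- multiplier of P_g and the square trick
  have hnP : ∀ g : ZMod 2 × ZMod 2, (π₁ ^ g.1.val * π₂ ^ g.2.val) * π = π ^ (μ ^ g.2.val) * (π₁ ^ g.1.val * π₂ ^ g.2.val) := by
    intro g
    have ha : π₁ ^ g.1.val * π = π ^ 1 * π₁ ^ g.1.val := by rw [pow_one]; exact (hc₁.pow_left _).eq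
    have h := norm_mul ha (norm_pow_left hn₂ g.2.val)
    rwa [one_mul] at h
  have hPsq : ∀ g : ZMod 2 × ZMod 2, (π₁ ^ g.1.val * π₂ ^ g.2.val) ^ 2 = 1 := by
    intro g
    rw [pow_two, ← v4_label_add hi₁ hi₂ hcm.symm, v4_facts.1 g]; simp
  rintro ⟨g, s⟩ ⟨h, t⟩ heq
  simp only at heq
  -- P_h x₀ = π^u (P_g x₀) with u = (167 - t) + s
  have e1 : (π₁ ^ h.1.val * π₂ ^ h.2.val) x₀ = (π ^ ((167 - t.val) + s.val)) ((π₁ ^ g.1.val * π₂ ^ g.2.val) x₀) := by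
    rw [pow_add, Equiv.Perm.mul_apply (π ^ (167 - t.val)) (π ^ s.val), heq,
      ← Equiv.Perm.mul_apply (π ^ (167 - t.val)) (π ^ t.val), ← pow_add, Nat.sub_add_cancel (ZMod.val_lt t).le, hπ,
      Equiv.Perm.one_apply]
  -- hence P_{g+h} x₀ lies in the orbit of x₀
  have hmem : (π₁ ^ (g + h).1.val * π₂ ^ (g + h).2.val) x₀ ∈ orbFin π 167 x₀ := by
    rw [v4_label_add hi₁ hi₂ hcm.symm, Equiv.Perm.mul_apply, e1, ← Equiv.Perm.mul_apply (π₁ ^ g.1.val * π₂ ^ g.2.val),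
      norm_comm_pow (hnP g), Equiv.Perm.mul_apply, ← Equiv.Perm.mul_apply (π₁ ^ g.1.val * π₂ ^ g.2.val), ← pow_two, hPsq,
      Equiv.Perm.one_apply]
    exact pow_apply_mem_orbFin π (by norm_num) hπ x₀ _
  rcases v4_cases (g + h) with hk | hk | hk | hk
  · -- g = h: then s = t
    have hg : g = h := v4_facts.2.2.1 g h hk
    subst hg
    have hst : s.val = t.val :=
      perm_pow_apply_injective π p167 hπ (hπfix _) (ZMod.val_lt s) (ZMod.val_lt t) heq
    rw [Prod.mk.injEq]
    exact ⟨rfl, ZMod.val_injective 167 hst⟩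
  · -- τ would preserve a block: impossible (free centraliser)
    exfalso
    rw [hk] at hmem
    simp only [ZMod.val_one, ZMod.val_zero, pow_one, pow_zero, mul_one] at hmem
    have hmem' : π₁ x₀ ∈ orbFin π 167 ((1 : Equiv.Perm ι) x₀) := by rw [Equiv.Perm.one_apply]; exact hmem
    obtain ⟨c, hc, hc'⟩ := hadamard668_order167_centralizer_eq_of_sameOrbit hH hι haut hπ hκ hne (isSignedAut_trivial H) h₁
      (Commute.one_left π) (Commute.one_left κ) hc₁ hc₁' hmem'
    rw [one_mul] at hc hc'
    have hπc : π ^ c = 1 := pow_eq_one_of_sq_pow_167 hπ (by rw [mul_comm, pow_mul, ← hc, hi₁])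
    have hκc : κ ^ c = 1 := pow_eq_one_of_sq_pow_167 hκ (by rw [mul_comm, pow_mul, ← hc', hi₁'])
    rcases hne₁ with h' | h'
    · exact h' (hc.trans hπc)
    · exact h' (hc'.trans hκc)
  · -- ρ would preserve a block: it would fix 4 rows
    exfalso
    rw [hk] at hmem
    simp only [ZMod.val_one, ZMod.val_zero, pow_one, pow_zero, one_mul] at hmem
    obtain ⟨-, -, h4, -⟩ := inverting_blocks_of_mem_orbFin hH hι haut hπ hκ hne h₂ hn₂ hn₂' hμ hmem
    obtain ⟨x, hx⟩ : (univ.filter fun x => π₂ x = x).Nonempty := by rw [← Finset.card_pos, h4]; norm_num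
    exact hfp x (Finset.mem_filter.mp hx).2
  · -- ρτ would preserve a block: it would fix 4 rows
    exfalso
    rw [hk] at hmem
    simp only [ZMod.val_one, pow_one] at hmem
    rw [hcm.symm.eq] at hmem
    have hn₁ : π₁ * π = π ^ 1 * π₁ := by rw [pow_one]; exact hc₁.eq
    have hn₁' : κ₁ * κ = κ ^ 1 * κ₁ := by rw [pow_one]; exact hc₁'.eq
    have hn : (π₂ * π₁) * π = π ^ μ * (π₂ * π₁) := by have h := norm_mul hn₂ hn₁; rwa [mul_one] at h
    have hn' : (κ₂ * κ₁) * κ = κ ^ μ * (κ₂ * κ₁) := by have h := norm_mul hn₂' hn₁'; rwa [mul_one] at h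
    obtain ⟨-, -, h4, -⟩ := inverting_blocks_of_mem_orbFin hH hι haut hπ hκ hne (isSignedAut_mul h₂ h₁) hn hn' hμ hmem
    obtain ⟨x, hx⟩ : (univ.filter fun x => (π₂ * π₁) x = x).Nonempty := by rw [← Finset.card_pos, h4]; norm_num
    exact hfp' x (Finset.mem_filter.mp hx).2

/-- **Ito-type shape.**  Under the hypotheses above, `H` is equivalent to a Hadamard matrix
`M ((g,s),(h,t)) = θ g h · A (g + h) (ε_g (t − s))` on `(ℤ/2 × ℤ/2) × ℤ/167` with `ε_g = +1` if `g₂ = 0` and `ε_g = −1` if `g₂ = 1`: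
a `V₄`-twisted `4 × 4` array of four circulant `±1` blocks of order `167` whose two inverting block-rows carry the transposed
circulants, up to a `±1` sign table `θ`. -/
theorem exists_itoTypeArray_of_inverting_fpf :
    ∃ (θ : ZMod 2 × ZMod 2 → ZMod 2 × ZMod 2 → ℤ) (A : ZMod 2 × ZMod 2 → ZMod 167 → ℤ),
      (∀ g h, θ g h = 1 ∨ θ g h = -1) ∧ (∀ k r, A k r = 1 ∨ A k r = -1) ∧
      IsHadamardMatrix (Matrix.of fun (a b : (ZMod 2 × ZMod 2) × ZMod 167) =>
        θ a.1 b.1 * A (a.1 + b.1) (if a.1.2 = 0 then b.2 - a.2 else a.2 - b.2)) ∧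
      Fintype.card ((ZMod 2 × ZMod 2) × ZMod 167) = 668 := by
  have p167 : Nat.Prime 167 := by norm_num
  have hcard : (Fintype.card ι : ℤ) ≠ 0 := by rw [hι]; norm_num
  obtain ⟨hi₂, hi₂'⟩ := hadamard668_order167_inverting_sq_eq_one hH hι haut hπ hκ hne h₂ hn₂ hn₂' hμ
  obtain ⟨hcm, hcm'⟩ := hadamard668_order167_inverting_commute_involution hH hι haut hπ hκ hne h₂ hn₂ hn₂' hμ h₁ hc₁ hc₁' hi₁
    hi₁'
  -- the inverting involutions ρ and ρτ fix no column either (all-or-none)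
  have hn₁ : π₁ * π = π ^ 1 * π₁ := by rw [pow_one]; exact hc₁.eq
  have hn₁' : κ₁ * κ = κ ^ 1 * κ₁ := by rw [pow_one]; exact hc₁'.eq
  have hn : (π₂ * π₁) * π = π ^ μ * (π₂ * π₁) := by have h := norm_mul hn₂ hn₁; rwa [mul_one] at h
  have hn' : (κ₂ * κ₁) * κ = κ ^ μ * (κ₂ * κ₁) := by have h := norm_mul hn₂' hn₁'; rwa [mul_one] at h
  have hfpC : ∀ y, κ₂ y ≠ y := by
    rcases hadamard668_order167_inverting_all_or_none hH hι haut hπ hκ hne h₂ hn₂ hn₂' hμ with ⟨-, -, h4, -⟩ | ⟨-, -, -, h0, -⟩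
    · exfalso
      obtain ⟨x, hx⟩ : (univ.filter fun x => π₂ x = x).Nonempty := by rw [← Finset.card_pos, h4]; norm_num
      exact hfp x (Finset.mem_filter.mp hx).2
    · exact moved_of_card_fixed_eq_zero κ₂ h0
  have hfpC' : ∀ y, (κ₂ * κ₁) y ≠ y := by
    rcases hadamard668_order167_inverting_all_or_none hH hι haut hπ hκ hne (isSignedAut_mul h₂ h₁) hn hn' hμ with
      ⟨-, -, h4, -⟩ | ⟨-, -, -, h0, -⟩
    · exfalso
      obtain ⟨x, hx⟩ : (univ.filter fun x => (π₂ * π₁) x = x).Nonempty := by rw [← Finset.card_pos, h4]; norm_num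
      exact hfp' x (Finset.mem_filter.mp hx).2
    · exact moved_of_card_fixed_eq_zero _ h0
  -- re-sign: σ is a permutation automorphism of H'
  obtain ⟨s, t, hs, ht, hH', hinv⟩ := exists_resign_of_odd hH haut (by decide : Odd 167) hπ hκ
  set H' : Matrix ι ι ℤ := Matrix.of fun i j => s i * t j * H i j with hH'def
  have hinv' : ∀ i j, H' (π i) (κ j) = H' i j := fun i j => by
    simp only [hH'def, Matrix.of_apply]; exact hinv i j
  have hinvm : ∀ m i j, H' ((π ^ m) i) ((κ ^ m) j) = H' i j := perm_aut_pow hinv'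
  have hH'ne : ∀ i j, H' i j ≠ 0 := fun i j => pm_ne_zero (hH'.1 i j)
  -- labels and their multipliers
  set P : ZMod 2 × ZMod 2 → Equiv.Perm ι := fun g => π₁ ^ g.1.val * π₂ ^ g.2.val with hPdef
  set Q : ZMod 2 × ZMod 2 → Equiv.Perm ι := fun g => κ₁ ^ g.1.val * κ₂ ^ g.2.val with hQdef
  set D' : ZMod 2 × ZMod 2 → ι → ℤ := fun g i =>
    s (P g i) * s i * (cyc π₁ d₁ ((π₂ ^ g.2.val) i) g.1.val * cyc π₂ d₂ i g.2.val) with hD'def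
  set E' : ZMod 2 × ZMod 2 → ι → ℤ := fun g j =>
    t (Q g j) * t j * (cyc κ₁ e₁ ((κ₂ ^ g.2.val) j) g.1.val * cyc κ₂ e₂ j g.2.val) with hE'def
  have hT' : ∀ g, IsSignedAut H' (P g) (Q g) (D' g) (E' g) :=
    fun g => signedAut_resign' hs ht (isSignedAut_mul (isSignedAut_pow h₁ g.1.val) (isSignedAut_pow h₂ g.2.val))
  have hnP : ∀ g, P g * π = π ^ (μ ^ g.2.val) * P g := by
    intro g
    have ha : π₁ ^ g.1.val * π = π ^ 1 * π₁ ^ g.1.val := by rw [pow_one]; exact (hc₁.pow_left _).eq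
    have h := norm_mul ha (norm_pow_left hn₂ g.2.val)
    rwa [one_mul] at h
  have hnQ : ∀ g, Q g * κ = κ ^ (μ ^ g.2.val) * Q g := by
    intro g
    have ha : κ₁ ^ g.1.val * κ = κ ^ 1 * κ₁ ^ g.1.val := by rw [pow_one]; exact (hc₁'.pow_left _).eq
    have h := norm_mul ha (norm_pow_left hn₂' g.2.val)
    rwa [one_mul] at h
  have hQadd : ∀ g h, Q (g + h) = Q g * Q h := fun g h => v4_label_add hi₁' hi₂' hcm'.symm g h
  obtain ⟨x₀⟩ : Nonempty ι := Fintype.card_pos_iff.mp (by rw [hι]; norm_num)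
  set y₀ := x₀ with hy₀
  have hconst : ∀ g, (∀ k x, D' g ((π ^ k) x) = D' g x) ∧ (∀ k y, E' g ((κ ^ k) y) = E' g y) :=
    fun g => signs_const_of_normalizing hH'ne hinv' (by decide : Odd 167) hπ (hT' g) (hnP g) (hnQ g) x₀
  -- μ_g² ≡ 1: the power trick
  have hμ' : (μ : ZMod 167) = -1 := by
    rw [← ZMod.natCast_mod μ 167, hμ]; exact zmod167_166
  have hμb : ∀ b k : ℕ, ((μ ^ b * (μ ^ b * k) : ℕ) : ZMod 167) = (k : ZMod 167) := by
    intro b k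
    push_cast
    rw [← mul_assoc, ← pow_add, hμ', ← two_mul, pow_mul, neg_one_sq, one_pow, one_mul]
  have hππ : ∀ b k : ℕ, π ^ (μ ^ b * (μ ^ b * k)) = π ^ k := fun b k => pow_eq_pow_of_natCast_eq_n hπ (hμb b k)
  have hκκ : ∀ b k : ℕ, κ ^ (μ ^ b * (μ ^ b * k)) = κ ^ k := fun b k => pow_eq_pow_of_natCast_eq_n hκ (hμb b k)
  -- the bijections
  let fR : (ZMod 2 × ZMod 2) × ZMod 167 → ι := fun a => (π ^ a.2.val) (P a.1 x₀)
  let fC : (ZMod 2 × ZMod 2) × ZMod 167 → ι := fun b => (κ ^ b.2.val) (Q b.1 y₀)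
  have hcardV : Fintype.card ((ZMod 2 × ZMod 2) × ZMod 167) = 668 := by simp [ZMod.card]
  have hbR : Function.Bijective fR :=
    ito_orbitMap_bijective hH hι haut hπ hκ hne h₁ hc₁ hc₁' hi₁ hi₁' hne₁ h₂ hn₂ hn₂' hμ hfp hfp' x₀
  have hbC : Function.Bijective fC := by
    have hT := isHadamard_transpose hH hcard
    exact ito_orbitMap_bijective hT hι (isSignedAut_transpose haut) hκ hπ hne.symm (isSignedAut_transpose h₁) hc₁' hc₁ hi₁'
      hi₁ hne₁.symm (isSignedAut_transpose h₂) hn₂' hn₂ hμ hfpC hfpC' y₀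
  let ER : (ZMod 2 × ZMod 2) × ZMod 167 ≃ ι := Equiv.ofBijective fR hbR
  let EC : (ZMod 2 × ZMod 2) × ZMod 167 ≃ ι := Equiv.ofBijective fC hbC
  -- the data
  refine ⟨fun g h => D' g x₀ * E' g (Q (g + h) y₀), fun k r => H' x₀ ((κ ^ r.val) (Q k y₀)), ?_, fun k r => hH'.1 _ _,
    ?_, hcardV⟩
  · intro g h
    rcases (hT' g).1 x₀ with h1 | h1 <;> rcases (hT' g).2.1 (Q (g + h) y₀) with h2 | h2 <;> simp [h1, h2]
  -- the array is the reindexed H'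
  have hentry : ∀ a b : (ZMod 2 × ZMod 2) × ZMod 167,
      D' a.1 x₀ * E' a.1 (Q (a.1 + b.1) y₀) *
          H' x₀ ((κ ^ (if a.1.2 = 0 then b.2 - a.2 else a.2 - b.2).val) (Q (a.1 + b.1) y₀)) = H' (ER a) (EC b) := by
    rintro ⟨g, s'⟩ ⟨h, t'⟩
    show D' g x₀ * E' g (Q (g + h) y₀) * H' x₀ ((κ ^ (if g.2 = 0 then t' - s' else s' - t').val) (Q (g + h) y₀)) =
      H' ((π ^ s'.val) (P g x₀)) ((κ ^ t'.val) (Q h y₀))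
    have hQh : Q h = Q g * Q (g + h) := by rw [← hQadd, v4_facts.2.1]
    have e2 : (π ^ s'.val) (P g x₀) = P g ((π ^ (μ ^ g.2.val * s'.val)) x₀) := by
      rw [← Equiv.Perm.mul_apply (π ^ s'.val) (P g), ← hππ g.2.val s'.val, ← norm_comm_pow (hnP g) (μ ^ g.2.val * s'.val),
        Equiv.Perm.mul_apply (P g) (π ^ (μ ^ g.2.val * s'.val))]
    have e1 : (κ ^ t'.val) (Q h y₀) = Q g ((κ ^ (μ ^ g.2.val * t'.val)) (Q (g + h) y₀)) := by
      rw [hQh, Equiv.Perm.mul_apply (Q g) (Q (g + h)), ← Equiv.Perm.mul_apply (κ ^ t'.val) (Q g), ← hκκ g.2.val t'.val,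
        ← norm_comm_pow (hnQ g) (μ ^ g.2.val * t'.val), Equiv.Perm.mul_apply (Q g) (κ ^ (μ ^ g.2.val * t'.val))]
    rw [e1, e2, (hT' g).2.2, (hconst g).1, (hconst g).2]
    -- H'(π^a x₀, κ^b z) = H'(x₀, κ^r z) with b ≡ a + r
    have hexp : ((μ ^ g.2.val * t'.val : ℕ) : ZMod 167) =
        ((μ ^ g.2.val * s'.val + (if g.2 = 0 then t' - s' else s' - t').val : ℕ) : ZMod 167) := by
      by_cases hg : g.2 = 0
      · rw [if_pos hg, hg, ZMod.val_zero, pow_zero, one_mul, one_mul]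
        push_cast
        rw [ZMod.natCast_zmod_val, ZMod.natCast_zmod_val, ZMod.natCast_zmod_val]; ring
      · have hg1 : g.2 = 1 := zmod2_eq_one_of_ne_zero _ hg
        rw [if_neg hg, hg1, ZMod.val_one, pow_one]
        push_cast
        rw [ZMod.natCast_zmod_val, ZMod.natCast_zmod_val, ZMod.natCast_zmod_val, hμ']; ring
    have e3 : κ ^ (μ ^ g.2.val * t'.val) = κ ^ (μ ^ g.2.val * s'.val) * κ ^ (if g.2 = 0 then t' - s' else s' - t').val := by
      rw [← pow_add]; exact pow_eq_pow_of_natCast_eq_n hκ hexp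
    rw [e3, Equiv.Perm.mul_apply (κ ^ (μ ^ g.2.val * s'.val)) (κ ^ (if g.2 = 0 then t' - s' else s' - t').val), hinvm]
  have hM : (Matrix.of fun (a b : (ZMod 2 × ZMod 2) × ZMod 167) =>
      D' a.1 x₀ * E' a.1 (Q (a.1 + b.1) y₀) *
        H' x₀ ((κ ^ (if a.1.2 = 0 then b.2 - a.2 else a.2 - b.2).val) (Q (a.1 + b.1) y₀))) = H'.submatrix ER EC := by
    ext a b
    rw [Matrix.of_apply, Matrix.submatrix_apply, hentry]
  rw [hM]
  refine ⟨fun a b => hH'.1 _ _, ?_⟩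
  rw [Matrix.transpose_submatrix, Matrix.submatrix_mul_equiv, hH'.2]
  ext a b
  rw [Matrix.submatrix_apply, Matrix.smul_apply, Matrix.one_apply, Matrix.smul_apply, Matrix.one_apply, hι]
  simp only [EmbeddingLike.apply_eq_iff_eq]
  simp [ZMod.card]

end main

end Summit.Ventures.DiscreteObjects.Hadamard
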